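import Literature.MathematicalPhysics.QuantumLattice.DWaveSourceNNNHoppingFlatTwistWindowHamiltonian
import Literature.MathematicalPhysics.QuantumLattice.DWaveSourceNNNHoppingWindowCertificate
import HarnessLib

/-!
# Window certificates for the FLAT-TWISTED pair-sourced `t–t'` Hubbard tori: a local sum-of-squares identity in a
# window algebra bounds the ground-state energy of `dWaveSourceTorusTT'Twist L t' U μ h n` from BELOW on every large
# torus of the trivial-holonomy ladder

Topic `Literature/MathematicalPhysics/QuantumLattice` (namespace = path; family `hubbard`). The twisted twin of
`DWaveSourceNNNHoppingWindowCertificate.lean` (`dWaveSourceTorusTT'_groundEnergy_ge_of_window_certificate_d4`), built on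
`DWaveSourceNNNHoppingFlatTwistWindowHamiltonian.lean` (the twisted window Hamiltonian `H^{tw}_{Λ'}(κ)`, its commutator
locality on the torus at trivial holonomy, translation / `S^z` invariance of the twisted torus) and on the periodisation
identity `sum_relabel_translate_dWaveSourceEnergyObsTT'Twist` (`DWaveSourceNNNHoppingFlatTwistLocalDensity.lean`). It is
the LEAN HALF of the producer the Hubbard cuprate cell's rows T8 / T8′ lack (`hubbard-cq`, lead RULING 156 (3) / 160
(2)): any future level-2/3 reduced-density-matrix (SDP) run on a twisted torus that outputs such an identity is read,
through this file, as the cell `TwistedSourcedEnergyLowerRow` of `Rows/SourcedHelicityChord.lean`, i.e. as the `lo` slot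
of `dWaveOrderParameterTT'Twist_le_of_windows` (ceiling on the pair-density-wave order parameter) and of
`sourcedHelicityDensity_floor_of_rows` (floor on the helicity chord density).

* **`dWaveSourceTorusTT'Twist_groundEnergy_ge_of_window_certificate`**: ONE identity in `𝔄_{Λ'}`
  (`dWaveSourceWindow ⊆ Λ'`, `thicken Λ 1 ⊆ Λ'`)
  `Γ(incl)(E^src_κ) − c·1 = Σ Λₐᵦ Oₐᴴ O_b + (Σₖ [H^{tw}_{Λ'}(κ), Γ(incl)Bₖ] + Σₗ (Γ(incl)(Γ(shift vₗ) Yₗ) − Γ(incl) Yₗ)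
   + Σⱼ bⱼ • wⱼ) + (Σₘ dₘ • (Vₘᴴ − Vₘ) + Σₖ aₖ • vₖ)` (`wⱼ` `S^z`-charged ladder words, `vₖ` ladder words) gives, for
  every `L ≥ 3` with `x ↦ x mod L` injective on `thicken Λ' 1` and every twist `n` with `χ_L(n_i) = κ_i`,
  `(c − Σₖ ‖aₖ‖) · L² ≤ E₀(dWaveSourceTorusTT'Twist L tp U μ h n)` (full Fock space; Han 2020 §3 read through the
  tracial ground state, the tree's generic core `Matrix.mul_card_le_minEnergyOn_of_local_certificate`).
* `…_ladder`: the same along the ladder `L = b·k`, `n = p·k` (`κ = χ_b(p)`) for all `k` with `b·k ≥ L₀` — verbatim the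
  hypothesis shape of `Summit.Ventures.CertifiedManyBodySolver.TwistedSourcedEnergyLowerRow`.

v1 WITHOUT point-group defects: a flat twist breaks `D₄` (only translations and `S^z` are used as symmetries here; the
anti-unitary reflections of the twisted problem are engine-side business). HONEST SCOPE: soundness only — no certificate
is constructed or claimed; a bound at fixed `h > 0` on a twisted torus says nothing about `d`-wave or pair-density-wave
order. Everything is PROVED; no definition, no named fact.

## References
* X. Han, arXiv:2006.06002, §3 (bootstrapping ground states with reduced density matrices: positivity + `F[[H,O]] = 0`).
  [cite: Han2020Bootstrap, §3]
* J. Wang et al., PRX 14 (2024) 031006, §III (certified lower bounds from local SOS identities). [cite: WangEtAl2024, §III]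
* O. Bratteli, D. W. Robinson, *Operator Algebras and Quantum Statistical Mechanics 2* (1997), §6.2.4 (periodic
  boundary conditions; the tracial state argument). [cite: BratteliRobinsonII1997, §6.2.4]
* H. Watanabe, J. Stat. Phys. 177 (2019) 717, §2.2.1 (flat twists). [cite: Watanabe2019, §2.2.1]
-/

noncomputable section

namespace Literature.MathematicalPhysics.QuantumLattice

open Matrix Finset HubbardWave0 Literature.Probability.LatticeModels
open Literature.MathematicalPhysics.QuantumManyBody.StateRelaxation
open scoped ComplexOrder BigOperators

section Certificate

variable {L : ℕ} [NeZero L]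

/-- (Local to this section, as in `DWaveSourceNNNHoppingWindowCertificate`.) [folklore] -/
local instance (priority := high) instDecidableEqFermionTorusSrcTTTwistWindow : DecidableEq (FermionTorus 2 L) :=
  LinearOrder.toDecidableEq

/-- **Window certificate ⇒ ground-state energy of EVERY large flat-twisted pair-sourced `t–t'` torus of the ladder**:
the identity in `𝔄_{Λ'}` (`dWaveSourceWindow ⊆ Λ'`, `thicken Λ 1 ⊆ Λ'`, `S^z`-charged `wⱼ`)
`Γ(incl)(E^src_κ) − c·1 = Σ Λₐᵦ Oₐᴴ O_b + (Σₖ [H^{tw}_{Λ'}(κ), Γ(incl)Bₖ] + Σₗ (Γ(incl)(Γ(shift vₗ) Yₗ) − Γ(incl) Yₗ)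
 + Σⱼ bⱼ • wⱼ) + (Σₘ dₘ • (Vₘᴴ − Vₘ) + Σₖ aₖ • vₖ)` gives, for every `L ≥ 3` with `x ↦ x mod L` injective on
`thicken Λ' 1` and every twist `n ∈ (ℤ/L)²` with `χ_L(n_i) = κ_i`,
`(c − Σₖ ‖aₖ‖) · L² ≤ E₀(dWaveSourceTorusTT'Twist L tp U μ h n)` (full Fock space). [cite: Han2020Bootstrap, §3] -/
theorem dWaveSourceTorusTT'Twist_groundEnergy_ge_of_window_certificate (tp U μ h : ℝ) (κ : Fin 2 → Circle) (hL : 3 ≤ L)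
    {n : Fin 2 → ZMod L} (hκ : ∀ i, ZMod.toCircle (n i) = κ i)
    {Λ Λ' : Finset (Site 2)} (hΛ : Λ ⊆ Λ') (h8 : thicken Λ 1 ⊆ Λ') (hW : dWaveSourceWindow ⊆ Λ')
    (hInj : Set.InjOn (Torus.proj (d := 2) L) ↑(thicken Λ' 1))
    {m : Type*} [Fintype m] [DecidableEq m] {Λm : Matrix m m ℂ} (hΛm : Λm.PosSemidef)
    (O : m → FermionOp Λ')
    {ξ : Type*} (s : Finset ξ) (B : ξ → FermionOp Λ)
    {ι : Type*} (tt : Finset ι) (v : ι → Site 2) (hsh : ∀ l, shiftSet (v l) Λ ⊆ Λ') (Y : ι → FermionOp Λ)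
    {χ : Type*} (u : Finset χ) (b : χ → ℂ) (cw : χ → List (Orb (PolySite Λ') × Bool))
    (hcw : ∀ j ∈ u, ladderSpinCharge (cw j) ≠ 0)
    {δ : Type*} (ah : Finset δ) (dc : δ → ℝ) (V : δ → FermionOp Λ')
    {κ'' : Type*} (w : Finset κ'') (a : κ'' → ℂ) (word : κ'' → List (Orb (PolySite Λ') × Bool)) {c : ℝ}
    (hcert : fermionEmbed (PolySite.incl hW) (dWaveSourceEnergyObsTT'Twist tp U μ h κ) - (c : ℂ) • (1 : FermionOp Λ') =
      gramForm Λm O +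
        (∑ k ∈ s, (pairSourceWindowHamiltonianTT'Twist Λ' tp U μ h κ * fermionEmbed (PolySite.incl hΛ) (B k) -
            fermionEmbed (PolySite.incl hΛ) (B k) * pairSourceWindowHamiltonianTT'Twist Λ' tp U μ h κ) +
          ∑ l ∈ tt, (fermionEmbed (PolySite.incl (hsh l)) (fermionEmbed (PolySite.shiftEmb (v l) Λ) (Y l)) -
            fermionEmbed (PolySite.incl hΛ) (Y l)) +
          ∑ j ∈ u, b j • ladderWord (cw j)) +
        (∑ m' ∈ ah, ((dc m' : ℝ) : ℂ) • ((V m')ᴴ - V m') + ∑ k ∈ w, a k • ladderWord (word k))) :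
    (c - ∑ k ∈ w, ‖a k‖) * (L : ℝ) ^ 2 ≤ (dWaveSourceTorusTT'Twist L tp U μ h n).groundEnergy := by
  classical
  have hInj' : Set.InjOn (Torus.proj (d := 2) L) ↑Λ' := hInj.mono (by exact_mod_cast subset_thicken Λ' 1)
  have hInjΛ : Set.InjOn (Torus.proj (d := 2) L) ↑Λ := hInj'.mono (by exact_mod_cast hΛ)
  have hInjW : Set.InjOn (Torus.proj (d := 2) L) ↑dWaveSourceWindow := hInj'.mono (by exact_mod_cast hW)
  set Γ' := fermionEmbed (PolySite.toTorusEmb L hInj') with hΓ'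
  set ΓΛ := fermionEmbed (PolySite.toTorusEmb L hInjΛ) with hΓΛ
  set H := dWaveSourceTorusTT'Twist L tp U μ h n with hH
  have hHh : H.IsHermitian := isHermitian_dWaveSourceTorusTT'Twist L tp U μ h n
  set X := Γ' (fermionEmbed (PolySite.incl hW) (dWaveSourceEnergyObsTT'Twist tp U μ h κ)) with hX
  set T : TorusSite 2 L → Matrix (Finset (Orb (FermionTorus 2 L))) (Finset (Orb (FermionTorus 2 L))) ℂ :=
    fun v' => (fockTranslate v').val with hT
  have hTH : ∀ v', T v' * H = H * T v' := fun v' => fockTranslate_mul_dWaveSourceTorusTT'Twist L v' tp U μ h n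
  have hTT : ∀ v', (T v')ᴴ * T v' = 1 := fun v' => fockTranslate_conjTranspose_mul_self v'
  have hsum : ∑ v', T v' * X * (T v')ᴴ = H := by
    rw [hH, hX, hΓ', fermionEmbed_toTorusEmb_incl hW hInj',
      ← sum_relabel_translate_dWaveSourceEnergyObsTT'Twist hL hInjW tp U μ h κ n hκ]
    refine Finset.sum_congr rfl fun v' _ => ?_
    rw [relabel_eq_fockRelabel_conj]
  have hK : (⊤ : Submodule ℂ (Fock (Orb (FermionTorus 2 L)))) ≠ ⊥ := top_ne_bot
  set Us : ι → Matrix (Finset (Orb (FermionTorus 2 L))) (Finset (Orb (FermionTorus 2 L))) ℂ :=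
    fun l => (fockTranslate (Torus.proj L (v l))).val with hUs
  set Yt : ι → Matrix (Finset (Orb (FermionTorus 2 L))) (Finset (Orb (FermionTorus 2 L))) ℂ :=
    fun l => ΓΛ (Y l) with hYt
  have hU : ∀ l ∈ tt, Us l * H = H * Us l := fun l _ =>
    fockTranslate_mul_dWaveSourceTorusTT'Twist L (Torus.proj L (v l)) tp U μ h n
  have hUU : ∀ l ∈ tt, (Us l)ᴴ * Us l = 1 := fun l _ => fockTranslate_conjTranspose_mul_self _
  set emb : Orb (PolySite Λ') × Bool → Orb (FermionTorus 2 L) × Bool :=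
    fun p => (Orb.embMap (PolySite.toTorusEmb L hInj') p.1, p.2) with hemb
  set C : χ → Matrix (Finset (Orb (FermionTorus 2 L))) (Finset (Orb (FermionTorus 2 L))) ℂ :=
    fun _ => HubbardWave0.spinZ with hC
  set Wd : χ → Matrix (Finset (Orb (FermionTorus 2 L))) (Finset (Orb (FermionTorus 2 L))) ℂ :=
    fun j => (b j / (((ladderSpinCharge ((cw j).map emb) : ℤ) : ℂ) / 2)) • ladderWord ((cw j).map emb) with hWd
  have hC1 : ∀ j ∈ u, C j * H = H * C j := fun _ _ => spinZ_mul_dWaveSourceTorusTT'Twist L tp U μ h n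
  have hcharged : ∀ j ∈ u, Γ' (b j • ladderWord (cw j)) = C j * Wd j - Wd j * C j := by
    intro j hj
    have hq : (((ladderSpinCharge ((cw j).map emb) : ℤ) : ℂ) / 2) ≠ 0 := by
      rw [hemb, ladderSpinCharge_map_embMap]
      exact div_ne_zero (Int.cast_ne_zero.2 (hcw j hj)) two_ne_zero
    rw [fermionEmbed_smul, fermionEmbed_ladderWord, hC, hWd]
    simp only [Matrix.mul_smul, Matrix.smul_mul]
    rw [← smul_sub, spinZ_comm_ladderWord, smul_smul, div_mul_cancel₀ _ hq]
  set M : κ'' → Matrix (Finset (Orb (FermionTorus 2 L))) (Finset (Orb (FermionTorus 2 L))) ℂ :=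
    fun k => ladderWord ((word k).map emb) with hM
  have hMc : ∀ k ∈ w, (M k).IsContraction := fun k _ => by
    rw [hM]; dsimp only; rw [ladderWord_eq_prod]; exact isContraction_prod_ladder _
  have htorus : X - (c : ℂ) • (1 : Matrix (Finset (Orb (FermionTorus 2 L))) (Finset (Orb (FermionTorus 2 L))) ℂ) =
      gramForm Λm (fun i => Γ' (O i)) +
        (∑ k ∈ s, (H * Γ' (fermionEmbed (PolySite.incl hΛ) (B k)) - Γ' (fermionEmbed (PolySite.incl hΛ) (B k)) * H) +
          ∑ l ∈ tt, (Us l * Yt l * (Us l)ᴴ - Yt l) +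
          ∑ i ∈ (∅ : Finset (Fin 0)), ((0 : Matrix _ _ ℂ) * ((0 : Matrix _ _ ℂ) - (((0 : ℝ) : ℝ) : ℂ) • 1) +
            ((0 : Matrix _ _ ℂ) - (((0 : ℝ) : ℝ) : ℂ) • 1) * (0 : Matrix _ _ ℂ)) +
          ∑ j ∈ u, (C j * Wd j - Wd j * C j)) +
        (∑ m' ∈ ah, ((dc m' : ℝ) : ℂ) • ((Γ' (V m'))ᴴ - Γ' (V m')) + ∑ k ∈ w, a k • M k) := by
    have key := congrArg Γ' hcert
    rw [fermionEmbed_sub, fermionEmbed_smul, fermionEmbed_one] at key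
    have h1 : Γ' (∑ k ∈ s, (pairSourceWindowHamiltonianTT'Twist Λ' tp U μ h κ * fermionEmbed (PolySite.incl hΛ) (B k) -
        fermionEmbed (PolySite.incl hΛ) (B k) * pairSourceWindowHamiltonianTT'Twist Λ' tp U μ h κ)) =
        ∑ k ∈ s, (H * Γ' (fermionEmbed (PolySite.incl hΛ) (B k)) - Γ' (fermionEmbed (PolySite.incl hΛ) (B k)) * H) := by
      rw [fermionEmbed_sum]
      refine Finset.sum_congr rfl fun k _ => ?_
      rw [hH, hΓ', dWaveSourceTorusTT'Twist_commutator_fermionEmbed L hL hΛ h8 hInj tp U μ h hκ (B k)]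
    have h2 : Γ' (∑ l ∈ tt, (fermionEmbed (PolySite.incl (hsh l)) (fermionEmbed (PolySite.shiftEmb (v l) Λ) (Y l)) -
        fermionEmbed (PolySite.incl hΛ) (Y l))) = ∑ l ∈ tt, (Us l * Yt l * (Us l)ᴴ - Yt l) := by
      rw [fermionEmbed_sum]
      refine Finset.sum_congr rfl fun l _ => ?_
      rw [hUs, hYt, hΓΛ]
      exact fermionEmbed_toTorusEmb_shift_sub hΛ (v l) (hsh l) hInj' (Y l)
    have h3 : Γ' (∑ j ∈ u, b j • ladderWord (cw j)) = ∑ j ∈ u, (C j * Wd j - Wd j * C j) := by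
      rw [fermionEmbed_sum]
      exact Finset.sum_congr rfl hcharged
    have h4 : Γ' (∑ m' ∈ ah, ((dc m' : ℝ) : ℂ) • ((V m')ᴴ - V m')) =
        ∑ m' ∈ ah, ((dc m' : ℝ) : ℂ) • ((Γ' (V m'))ᴴ - Γ' (V m')) := by
      rw [fermionEmbed_sum]
      refine Finset.sum_congr rfl fun m' _ => ?_
      rw [fermionEmbed_smul, fermionEmbed_sub, hΓ', fermionEmbed_conjTranspose]
    have h5 : Γ' (∑ k ∈ w, a k • ladderWord (word k)) = ∑ k ∈ w, a k • M k := by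
      rw [fermionEmbed_sum]
      refine Finset.sum_congr rfl fun k _ => ?_
      rw [fermionEmbed_smul, hM, fermionEmbed_ladderWord]
    rw [hX, key, fermionEmbed_add, fermionEmbed_add, fermionEmbed_add, fermionEmbed_add, fermionEmbed_add, hΓ',
      fermionEmbed_gramForm, ← hΓ', h1, h2, h3, h4, h5, Finset.sum_empty, add_zero]
  have hmain := Matrix.mul_card_le_minEnergyOn_of_local_certificate hHh ⊤ (fun _ _ => Submodule.mem_top) hK
    X T hTH (fun _ _ _ => Submodule.mem_top) (fun _ _ _ => Submodule.mem_top) hTT hsum hΛm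
    (fun i => Γ' (O i)) s (fun k => Γ' (fermionEmbed (PolySite.incl hΛ) (B k))) tt Us Yt hU
    (fun _ _ _ _ => Submodule.mem_top) (fun _ _ _ _ => Submodule.mem_top) hUU
    (∅ : Finset (Fin 0)) (fun _ => 0) (fun _ => 0) (fun _ => 0) (fun _ => 0)
    (fun i hi => absurd hi (Finset.notMem_empty i)) (fun i hi => absurd hi (Finset.notMem_empty i))
    u C Wd hC1 (fun _ _ _ _ => Submodule.mem_top) (fun _ _ _ _ => Submodule.mem_top)
    ah dc (fun m' => Γ' (V m')) w a M hMc htorus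
  rw [card_torusSite, Matrix.minEnergyOn_top_holds hHh] at hmain
  exact_mod_cast hmain

end Certificate

/-- **Ladder form** (library instances; verbatim the hypothesis shape of the cell
`Summit.Ventures.CertifiedManyBodySolver.TwistedSourcedEnergyLowerRow tp U μ h b p L₀ e` with `e ≤ c − Σ‖aₖ‖`): one
twisted window certificate at bond phase `κ = χ_b(p)` gives `L₀` (`= max 3 L₁`, `L₁` from
`exists_forall_le_injOn_proj (thicken Λ' 1)`) with `(c − Σₖ ‖aₖ‖)·(bk)² ≤ E₀(dWaveSourceTorusTT'Twist (bk) tp U μ h (p·k))`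
for every `k ≥ 1` with `bk ≥ L₀`. [cite: Han2020Bootstrap, §3] -/
theorem dWaveSourceTorusTT'Twist_groundEnergy_ge_of_window_certificate_ladder (tp U μ h : ℝ) (b0 : ℕ) [NeZero b0]
    (p : Fin 2 → ℕ)
    {Λ Λ' : Finset (Site 2)} (hΛ : Λ ⊆ Λ') (h8 : thicken Λ 1 ⊆ Λ') (hW : dWaveSourceWindow ⊆ Λ')
    {m : Type*} [Fintype m] [DecidableEq m] {Λm : Matrix m m ℂ} (hΛm : Λm.PosSemidef)
    (O : m → FermionOp Λ')
    {ξ : Type*} (s : Finset ξ) (B : ξ → FermionOp Λ)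
    {ι : Type*} (tt : Finset ι) (v : ι → Site 2) (hsh : ∀ l, shiftSet (v l) Λ ⊆ Λ') (Y : ι → FermionOp Λ)
    {χ : Type*} (u : Finset χ) (b : χ → ℂ) (cw : χ → List (Orb (PolySite Λ') × Bool))
    (hcw : ∀ j ∈ u, ladderSpinCharge (cw j) ≠ 0)
    {δ : Type*} (ah : Finset δ) (dc : δ → ℝ) (V : δ → FermionOp Λ')
    {κ'' : Type*} (w : Finset κ'') (a : κ'' → ℂ) (word : κ'' → List (Orb (PolySite Λ') × Bool)) {c : ℝ}
    (hcert : fermionEmbed (PolySite.incl hW)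
          (dWaveSourceEnergyObsTT'Twist tp U μ h (fun i => ZMod.toCircle ((p i : ℕ) : ZMod b0))) -
        (c : ℂ) • (1 : FermionOp Λ') =
      gramForm Λm O +
        (∑ k ∈ s, (pairSourceWindowHamiltonianTT'Twist Λ' tp U μ h (fun i => ZMod.toCircle ((p i : ℕ) : ZMod b0)) *
              fermionEmbed (PolySite.incl hΛ) (B k) -
            fermionEmbed (PolySite.incl hΛ) (B k) *
              pairSourceWindowHamiltonianTT'Twist Λ' tp U μ h (fun i => ZMod.toCircle ((p i : ℕ) : ZMod b0))) +
          ∑ l ∈ tt, (fermionEmbed (PolySite.incl (hsh l)) (fermionEmbed (PolySite.shiftEmb (v l) Λ) (Y l)) -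
            fermionEmbed (PolySite.incl hΛ) (Y l)) +
          ∑ j ∈ u, b j • ladderWord (cw j)) +
        (∑ m' ∈ ah, ((dc m' : ℝ) : ℂ) • ((V m')ᴴ - V m') + ∑ k ∈ w, a k • ladderWord (word k))) :
    ∃ L₀ : ℕ, ∀ (k : ℕ) [NeZero k], L₀ ≤ b0 * k →
      (c - ∑ k ∈ w, ‖a k‖) * ((b0 * k : ℕ) : ℝ) ^ 2 ≤
        (dWaveSourceTorusTT'Twist (b0 * k) tp U μ h (fun i => ((p i * k : ℕ) : ZMod (b0 * k)))).groundEnergy := by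
  obtain ⟨L₁, hL₁⟩ := exists_forall_le_injOn_proj (thicken Λ' 1)
  refine ⟨max 3 L₁, fun k _ hk => ?_⟩
  convert dWaveSourceTorusTT'Twist_groundEnergy_ge_of_window_certificate tp U μ h
    (fun i => ZMod.toCircle ((p i : ℕ) : ZMod b0)) (le_trans (le_max_left _ _) hk)
    (n := fun i => ((p i * k : ℕ) : ZMod (b0 * k))) (fun i => toCircle_mul_eq b0 k (p i)) hΛ h8 hW
    (hL₁ _ (le_trans (le_max_right _ _) hk)) hΛm O s B tt v hsh Y u b cw hcw ah dc V w a word hcert using 2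

end Literature.MathematicalPhysics.QuantumLattice

end
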